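/-
Copyright (c) 2026. All rights reserved.
Released under Apache 2.0 license as described in the file LICENSE.
Authors: abc-iut cell, seat abc-iut-L5-t5 (wave 2, gen 2).
-/
import Literature.NumberTheory.NumberFields.RescaledCompletion
import Literature.IUT.LogVolume.FakeAdeleIndexLocalDegree
import HarnessLib

/-!
# The two local degrees of the cell agree: `localDeg F v` (RescaledCompletion) `=` `localDegree F v` (FakeAdeleIndex)

Proof-only bridge (no definitions). The abc-iut cell now carries TWO spellings of the local degree
`n_v = e_v f_v = [F_v : ℚ_{p_v}]` of a finite place `v` of a number field `F`:

* abc-iut-c312-3's `Literature.IUT.LogVolume.localDegree F v := ramIdx F v * resDeg F v`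
  (`FakeAdeleIndex`, the weight numerator "`[F_{0,v}:ℚ_p]`" of Dupuy–Hilado §3.6, consumed by the
  DH-level Cor. 3.12 files), with `e`, `f` in the `Ideal.ramificationIdx'/inertiaDeg' (p_v)` spelling;
* abc-iut-S7's `Literature.NumberTheory.NumberFields.localDeg F v := v.asIdeal.ramificationIdx ℤ *
  v.asIdeal.inertiaDeg ℤ` (`RescaledCompletion`, the exponent of the rescaled norm `‖·‖_v^{1/n_v}` under
  which `F_v` becomes a normed `ℚ_p`-algebra, consumed by the real tensor-packet instances).

Both are `[F_v : ℚ_{p_v}]` for the tree's canonical `ℚ_{p_v}`-algebra structure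
(`LocalField.adicCompletionPadicAlgebra`): `localDegree_eq_finrank` (abc-iut-L6-t16,
`FakeAdeleIndexLocalDegree`) and `RescaledCompletion.localDeg_eq_finrank` (abc-iut-S7). Hence they are
equal (`localDeg_eq_localDegree`), and every statement weighted by one may be read with the other
(`sum_localDeg`: `Σ_{v ∣ p} localDeg F v = [F : ℚ]`, the fundamental identity in S7's spelling).
Classical (Neukirch, *Algebraic Number Theory*, Ch. II (8.5): `Σ e_i f_i = n`; (6.8)); nothing here
bears on the disputed parts of the IUT corpus.
-/

noncomputable section

namespace Literature.IUT.LogVolume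

open NumberField IsDedekindDomain Literature.NumberTheory.NumberFields
open Literature.NumberTheory.GaloisRepresentations.LocalField

variable (F : Type) [Field F] [NumberField F] (v : HeightOneSpectrum (𝓞 F))

/-- **`localDeg F v = localDegree F v`**: abc-iut-S7's and abc-iut-c312-3's local degrees of a finite
place coincide (both equal `[F_v : ℚ_{p_v}]` for the canonical `ℚ_{p_v}`-structure of `F_v`).
[cite: NeukirchANT1999, Ch. II Prop. (8.5)] -/
theorem localDeg_eq_localDegree : localDeg F v = localDegree F v := by
  haveI : Fact (residueChar F v).Prime := ⟨residueChar_prime F v⟩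
  have h1 := RescaledCompletion.localDeg_eq_finrank F (residueChar F v) v (natCast_residueChar_mem F v)
  have h2 := localDegree_eq_finrank F v
  exact h1.trans h2.symm

/-- The same, pointwise as real numbers (the form in which the weights `n_v/[F:ℚ]` are consumed).
[cite: NeukirchANT1999, Ch. II Prop. (8.5)] -/
theorem localDeg_cast_eq_localDegree_cast : (localDeg F v : ℝ) = (localDegree F v : ℝ) := by
  rw [localDeg_eq_localDegree]

/-- **The fundamental identity in abc-iut-S7's spelling**: `Σ_{v ∣ p} localDeg F v = [F : ℚ]`
(abc-iut-c312-3's `sum_localDegree` transported along `localDeg_eq_localDegree`).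
[cite: NeukirchANT1999, Ch. II Prop. (8.5)] -/
theorem sum_localDeg (p : ℕ) [Fact p.Prime] :
    ∑ v ∈ placesOver F p, localDeg F v = Module.finrank ℚ F := by
  rw [← sum_localDegree F p]
  exact Finset.sum_congr rfl fun v _ => localDeg_eq_localDegree F v

/-- `[F_v : ℚ_{p_v}] = localDegree F v` read through abc-iut-S7's `RescaledCompletion` (whose
`ℚ_{p_v}`-algebra structure is the canonical one): the dimension over `ℚ_{p_v}` of the rescaled field is
the DH weight numerator. [cite: NeukirchANT1999, Ch. II Prop. (8.5)] -/
theorem finrank_rescaledCompletion_eq_localDegree :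
    haveI : Fact (residueChar F v).Prime := ⟨residueChar_prime F v⟩
    Module.finrank ℚ_[residueChar F v]
        (RescaledCompletion F (residueChar F v) v (natCast_residueChar_mem F v)) = localDegree F v := by
  haveI : Fact (residueChar F v).Prime := ⟨residueChar_prime F v⟩
  rw [← localDeg_eq_localDegree]
  exact (RescaledCompletion.localDeg_eq_finrank F (residueChar F v) v (natCast_residueChar_mem F v)).symm

end Literature.IUT.LogVolume
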